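import Summits.QuantumFields.BalabanUV.Beta.KernelWardRelativeEnd
import Summits.QuantumFields.BalabanUV.Beta.RelInvBorderedHessianStep

/-!
# The `hW` END for the co-dressed native spine with the bordered binder `𝕄_j := bhKStepAt` and its rules 3–4 DISCHARGED

an1's `KernelWardRelativeEnd.wardTransversal_flipK_TbalOf_JsBalBmNAtOf_ctrC` (and its parity form `…_ctrC_parity`) is THE typed root
of the Ward binder `hW` of `OneStepKernelFamily.d1Drift_of_D1Tel_D1Rep` for the wall family `JsBalBmNAtOf` at the centred root: it
takes an abstract spread bordered binder `M : ℕ → MKer 4 (Fib 3)` with rules 3–4 of the relative inverse against the co-dressed step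
covariances (`h3`, `h4`), the ℋ-column Ward law `hH`, the generator / contact / remainder families, and the pure-gauge jet laws
`hSd`, `hWd`, `hN0`/`hNt`.  This file instantiates `M := bhKStepAt 3 ρ_c Lc` — the same candidate as on the `hR` side
(`SpineRootedBmNReduced.…_ctrC_candidate`) — and DISCHARGES `hM`, `h3`, `h4` at EVERY step: `j = 0` by
`BorderedHessian.relInv_coDressKBmAt_KInvStep_zero_bhKAt` (an4/an2, gen 11), `j + 1` by
`BorderedHessian.relInv_coDressKBmAt_KInvStep_succ_bhKStepAt` (this lineage, gen 15: the straight-border candidate, blindness,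
residual blocks, comb transfer).  What remains hypothesised is exactly an1's list minus (`M`, `hM`, `h3`, `h4`).

HONEST FRAMING: [folklore] finite-dimensional wiring; one hypothesis group of ONE binder (hW) of row D1 removed — NOT D1, NOT
BetaPertH, NOT the continuum limit, NOT Clay.  Provenance: b2b-balaban β sub-cell, unit beta-an2 gen 15, 2026-08-20; over an1's
`KernelWardRelativeEnd` BY NAME; no existing file touched.
-/

open Finset
open scoped BigOperators
open Literature.MathematicalPhysics.QuantumFieldTheory
open Literature.MathematicalPhysics.QuantumFieldTheory.Balaban1983to89
open Literature.MathematicalPhysics.QuantumFieldTheory.Balaban1983to89.Beta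
open ExpKernelCalculus (MKer Decays BiLoc comp tr tadpole VertexFamily₂ shiftK)
open PolarizationSign (WardTransversal)
open KernelWard (divV divW)
open AffineAveraging (box toSite)
open AveragingContoursRooted (ctrOff ctrOff_mem_box)
open OneStepResolventKernel (Fib LocStencil JetData)
open OneStepKernelFamily (KInvStep colH vertexOfK TbalOf flipK)
open Summit.QuantumFields.BalabanUV.Beta.TameKernelCalculus
open Summit.QuantumFields.BalabanUV.Beta.ChartConjugation (conjV conjW)
open Summit.QuantumFields.BalabanUV.Beta.ChartConjugationRelative (RelInv)
open Summit.QuantumFields.BalabanUV.Beta.AxialDressingRooted (coDressKBmAt one_le_of_neZero axEc)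
open Summit.QuantumFields.BalabanUV.Beta.KernelWardRelative (gaugeWt)
open Summit.QuantumFields.BalabanUV.Beta.KernelWardRelativeEnd (wardTransversal_flipK_TbalOf_JsBalBmNAtOf_ctrC
  wardTransversal_flipK_TbalOf_JsBalBmNAtOf_ctrC_parity)
open Summit.QuantumFields.BalabanUV.Beta.BorderedHessian (sgnK bhKStepAt spr_bhKStepAt relInv_coDressKBmAt_KInvStep_zero_bhKAt
  relInv_coDressKBmAt_KInvStep_succ_bhKStepAt)

noncomputable section

namespace Summit.QuantumFields.BalabanUV.Beta.SpineRooted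

/-- [folklore] **RULES 1–4 OF THE CANDIDATE `bhKStepAt` AT EVERY STEP**: `RelInv G_j (bhKStepAt 3 ρ Lc j) (axEc ρ Lc)` for every in-block
root and every `j` — member `0` is `relInv_coDressKBmAt_KInvStep_zero_bhKAt` (`bhKStepAt … 0 = bhKAt …` by `rfl`), member `j + 1` is
`relInv_coDressKBmAt_KInvStep_succ_bhKStepAt`. -/
theorem relInv_coDressKBmAt_KInvStep_bhKStepAt_all {d Lc : ℕ} [NeZero Lc] {r : Fin (d + 1) → ℕ} (hr : r ∈ box (d + 1) Lc) :
    ∀ j : ℕ, RelInv (coDressKBmAt (toSite r) Lc (KInvStep (d := d) Lc j)) (bhKStepAt d (toSite r) Lc j) (axEc (toSite r) Lc)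
  | 0 => relInv_coDressKBmAt_KInvStep_zero_bhKAt hr
  | j + 1 => relInv_coDressKBmAt_KInvStep_succ_bhKStepAt hr j

section Ward

variable {Lc : ℕ} [NeZero Lc] (hLc : Odd Lc) (cE cVH cΛ : ℝ)
    (W : ℕ → Fin 4 → (Fin 4 → ℤ) → Fin 4 → (Fin 4 → ℤ) → MKer 4 (Fib 3)) (Cw δw : ℕ → ℝ) (hδw : ∀ j, 0 < δw j)
    (hW : ∀ j, VertexFamily₂ (W j) Lc (Cw j) (δw j))
    (hWt : ∀ (j : ℕ) (μ : Fin 4) (y : Fin 4 → ℤ) (ν : Fin 4) (y' t : Fin 4 → ℤ),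
      W j μ (y + t) ν (y' + t) = shiftK (-((Lc : ℤ) • t)) (W j μ y ν y'))
    (cH : ℕ → ℝ) (hH : ∀ (j : ℕ) (y : Fin 4 → ℤ) (κ' : Fin 4) (u : Fin 4 → ℤ),
      ∑ μ, (colH (coDressKBmAt (toSite (ctrOff 4 Lc)) Lc (KInvStep (d := 3) Lc j)) Lc μ (y - B6BondElimination.unitVec μ) κ' u
        - colH (coDressKBmAt (toSite (ctrOff 4 Lc)) Lc (KInvStep (d := 3) Lc j)) Lc μ y κ' u) = cH j * gaugeWt Lc y κ' u)
    (X : ℕ → (Fin 4 → ℤ) → MKer 4 (Fib 3)) (hX : ∀ j y, Loc (X j y))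
    (hEX : ∀ j y, comp (axEc (toSite (ctrOff 4 Lc)) Lc) (X j y) = comp (X j y) (axEc (toSite (ctrOff 4 Lc)) Lc))
    (X₂ Nr : ℕ → (Fin 4 → ℤ) → Fin 4 → (Fin 4 → ℤ) → MKer 4 (Fib 3)) (hX₂ : ∀ j y ν y', Loc (X₂ j y ν y'))
    (hNr : ∀ j y ν y', Loc (Nr j y ν y'))
    (hEX₂ : ∀ j y ν y', comp (axEc (toSite (ctrOff 4 Lc)) Lc) (X₂ j y ν y') = comp (X₂ j y ν y') (axEc (toSite (ctrOff 4 Lc)) Lc))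
    (hSd : ∀ (j : ℕ) (y : Fin 4 → ℤ), cH j • ∑ v ∈ box 4 Lc,
      divV (JsBal0NAtOf (d := 3) hLc.pos (ctrOff_mem_box hLc.pos) cE cVH cΛ W Cw δw hδw hW j).S ((Lc : ℤ) • y + toSite v) =
        conjV (bhKStepAt 3 (toSite (ctrOff 4 Lc)) Lc j) (X j y))
    (hWd : ∀ (j : ℕ) (y : Fin 4 → ℤ) (ν : Fin 4) (y' : Fin 4 → ℤ),
      divW (JsBal0NAtOf (d := 3) hLc.pos (ctrOff_mem_box hLc.pos) cE cVH cΛ W Cw δw hδw hW j).W y ν y' =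
        conjW (bhKStepAt 3 (toSite (ctrOff 4 Lc)) Lc j) 0 (vertexOfK (coDressKBmAt (toSite (ctrOff 4 Lc)) Lc (KInvStep (d := 3) Lc j)) Lc
          (JsBal0NAtOf (d := 3) hLc.pos (ctrOff_mem_box hLc.pos) cE cVH cΛ W Cw δw hδw hW j).S ν y') (X j y) 0 (X₂ j y ν y') +
          Nr j y ν y')

include hWt hH hX hEX hX₂ hNr hEX₂ hSd hWd

/-- [folklore] **THE `hW` END FOR THE WALL FAMILY WITH THE CANDIDATE `𝕄_j := bhKStepAt 3 ρ_c Lc j`, RULES 3–4 DISCHARGED** — an1's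
`KernelWardRelativeEnd.wardTransversal_flipK_TbalOf_JsBalBmNAtOf_ctrC` with `M := bhKStepAt 3 (toSite (ctrOff 4 Lc)) Lc`, `hM` :=
`spr_bhKStepAt`, `h3`/`h4` := `relInv_coDressKBmAt_KInvStep_bhKStepAt_all`.  Remaining sockets: the ℋ-column Ward law `hH`, the
generator family `X` (`hX`, `hEX`), the second-order contacts `X₂` and remainders `Nr` (`hX₂`, `hNr`, `hEX₂`), the pure-gauge jet laws
`hSd` (first order, against `conjV (bhKStepAt … j) (X j y)`), `hWd` (second order) and the scalar remainder socket `hN0`. -/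
theorem wardTransversal_flipK_TbalOf_JsBalBmNAtOf_ctrC_relInv
    (hN0 : ∀ j y ν y', tadpole (coDressKBmAt (toSite (ctrOff 4 Lc)) Lc (KInvStep (d := 3) Lc j)) (Nr j y ν y') = 0) :
    ∀ j : ℕ, WardTransversal
      (flipK (TbalOf Lc (JsBalBmNAtOf (d := 3) hLc.pos (ctrOff_mem_box hLc.pos) cE cVH cΛ W Cw δw hδw hW) j)) :=
  wardTransversal_flipK_TbalOf_JsBalBmNAtOf_ctrC hLc cE cVH cΛ W Cw δw hδw hW hWt (bhKStepAt 3 (toSite (ctrOff 4 Lc)) Lc)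
    (spr_bhKStepAt (ctrOff_mem_box (one_le_of_neZero Lc)))
    (fun j => (relInv_coDressKBmAt_KInvStep_bhKStepAt_all (d := 3) (ctrOff_mem_box (one_le_of_neZero Lc)) j).AME)
    (fun j => (relInv_coDressKBmAt_KInvStep_bhKStepAt_all (d := 3) (ctrOff_mem_box (one_le_of_neZero Lc)) j).EMA)
    cH hH X hX hEX X₂ Nr hX₂ hNr hEX₂ hSd hWd hN0

/-- [folklore] **THE SAME, PARITY FORM OF THE REMAINDER SOCKET** (an1's `…_ctrC_parity` with `𝕄_j := bhKStepAt`, rules 3–4 discharged):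
the scalar socket `hN0` replaced by the structural one `hNt : trK (Nr …) = −sgnK (Nr …)`. -/
theorem wardTransversal_flipK_TbalOf_JsBalBmNAtOf_ctrC_relInv_parity
    (hNt : ∀ j y ν y', trK (Nr j y ν y') = -sgnK (Nr j y ν y')) :
    ∀ j : ℕ, WardTransversal
      (flipK (TbalOf Lc (JsBalBmNAtOf (d := 3) hLc.pos (ctrOff_mem_box hLc.pos) cE cVH cΛ W Cw δw hδw hW) j)) :=
  wardTransversal_flipK_TbalOf_JsBalBmNAtOf_ctrC_parity hLc cE cVH cΛ W Cw δw hδw hW hWt (bhKStepAt 3 (toSite (ctrOff 4 Lc)) Lc)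
    (spr_bhKStepAt (ctrOff_mem_box (one_le_of_neZero Lc)))
    (fun j => (relInv_coDressKBmAt_KInvStep_bhKStepAt_all (d := 3) (ctrOff_mem_box (one_le_of_neZero Lc)) j).AME)
    (fun j => (relInv_coDressKBmAt_KInvStep_bhKStepAt_all (d := 3) (ctrOff_mem_box (one_le_of_neZero Lc)) j).EMA)
    cH hH X hX hEX X₂ Nr hX₂ hNr hEX₂ hSd hWd hNt

end Ward

end Summit.QuantumFields.BalabanUV.Beta.SpineRooted

end
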